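/-
Copyright: statement-level skeleton of a published paper (lit-balaban cell, Phase-2 proof seat p25, gen 21). No proof
claims beyond what the kernel checks below.
-/
import Literature.MathematicalPhysics.QuantumFieldTheory.BalabanImbrieJaffe1984to88.BIJ88WalkProductCutoffVolFree312
import Literature.MathematicalPhysics.QuantumFieldTheory.BalabanImbrieJaffe1984to88.BIJ88WalkIneq312RemainderBdryNC
import Literature.MathematicalPhysics.QuantumFieldTheory.BalabanImbrieJaffe1984to88.BIJ88WalkLocalTermCountW312
import Literature.MathematicalPhysics.QuantumFieldTheory.BalabanImbrieJaffe1984to88.BIJ88WalkWeightedLocalitySupports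

/-!
# `BalabanImbrieJaffe1984to88.BIJ88WalkProductCutoffWeighted312` — T. Bałaban, J. Imbrie, A. Jaffe, *Effective action
and cluster properties of the abelian Higgs model*, Commun. Math. Phys. **114** (1988) 257–315 [BalabanImbrieJaffe1988],
§5.14 p. 312 [PDF 56], verbatim (x2 render `lit-balaban-r16/renders/cmp114/original-p056-x2.png`): *"These
considerations lead to the following estimate: |G_k(X)| ≤ c(F(X))(e^β(L^kε/ε₀)^{1/4−α})^{β′|X∖∪_cX_c|} ×
Π_{X_{σ_1} ⊂ X : dist(X_{σ_1}, Λ₁₂^{(k)c}) < r(e_k)} [c(L^kε)^{−m(c)}e^{−m′(c)}]."*, p. 310 [PDF 54]: *"The others,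
localized in region X, have a factor of e^{−cr(e_k)|X|}. We also consider as remainders any terms
whose order in λ and e is greater than n̄."*, *"(We allow adjustments in β, α, β′, keeping them small.)"* (after the
W₆′ estimate) and (5.2.1)–(5.2.4) p. 278 (the product cutoffs) — **THE HEAD THEOREM OF ROW C2.Claim@312
FOR PRINT'S PRODUCT CUTOFFS WITH THE LOCAL COUNT ABSTRACTED, AND UNDER GEOMETRIC LOCALITY DATA** (p25 gen 21; file
W5, a MEMBER of the row, owner r16, referee ref-5; the head of record
`BIJ88WalkIneq312RemainderBdry.ineq312_remainder_bdry` and every earlier file UNCHANGED).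

Gen 21's `BIJ88WalkProductCutoffVolFree312.ineq312_remainder_bdry_prodCutoff_N` discharges the expectation clause
`hE` for print's product cutoffs in the volume-free `ℓ¹` currency but still carries the uniform locality letter `N₀`
(a volume for a non-local piece) in `W_O = max(1, ρ₀(Φ₀+N₀))`.  Here the same instance is assembled on
`BIJ88WalkIneq312RemainderBdryNC.ineq312_remainder_bdry_NC` (ANY admissible local count `C_O`:
`ineq312_remainder_bdry_prodCutoff_NC`) and, composing with `BIJ88WalkWeightedLocalitySupports.weighted_locality_of_reach`
and the weighted count `BIJ88WalkLocalTermCountW312.expand_lsum_init_le_W`, under locality from the reach of the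
pieces, one-cube legs and per-cube weight sums (`ineq312_remainder_bdry_prodCutoff_of_reach`,
`W_O = max(1, ρ₀Φ₀(O) + Lρ₁)`; cf. `BIJ88WalkIneq312WeightedLocality.ineq312_remainder_bdry_of_reach` for a general
cutoff) — the entry points a walk-split instance (print's (2.45)) feeds.

statement-level skeleton of published theorems with citation tags; proofs where landed; nothing here is a claim
about the Yang–Mills mass gap

PDF held: `paper:balaban1988-cmp114-bij-abelian-higgs-effective-action` (journal page = PDF page + 256); p. 312 =
PDF 56, p. 310 = PDF 54, p. 278 = PDF 22.

CITATION HEADER (lean-in-tree rule).  lit-balaban cell (HOME `run/shared/lean/pub/lit-balaban/`), Phase 2, seat p25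
gen 21; row **C2.Claim@312** of `HOME/lit-balaban-r16/ROWS-C2-part2.md` (owner r16, referee ref-5; MEMBER).  USED BY
NAME, nothing restated: `BIJ88WalkProductCutoffVolFree312.prodCutoff_hE_N`, `BIJ88WalkIneq312RemainderBdryNC.ineq312_remainder_bdry_NC`,
`BIJ88WalkLocalTermCountW312.expand_lsum_init_le_W`, `BIJ88WalkWeightedLocalitySupports.weighted_locality_of_reach`
(p25 gen 21), the typed leaf
`BIJ88Sect5StatementsPart4.Ineq312` (r16), `BIJ88WalkIneq312Remainder.{remSys, phi0}`, `BIJ88WalkRemainderActivity312.{remAt,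
nfreeOf}`, `BIJ88WalkTermCount312.pw`, `BIJ88WalkExpansionGeo311.NondegT`, the §5.13 model of record.

## What is proved (0 `sorry`, standard axioms, no new `Prop` facts; theorems only, no definitions)

* **`ineq312_remainder_bdry_prodCutoff_NC`** (product cutoffs, `hE` discharged, count abstracted: `c_F = K_V·Λ_O·C_O`);
* **`ineq312_remainder_bdry_prodCutoff_of_reach`** (product cutoffs, `hE` discharged, locality from reach data).
HONEST SCOPE: that of `BIJ88WalkProductCutoffVolFree312` with the locality clause replaced as stated: (a) `e^{−V}`
bounded and field-INDEPENDENT (`K_V`); (b) `B′_p ρ_p`, `θ`'s, the count `C_O` / the reach data and per-cube sums are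
HYPOTHESES — no walk expansion, no covariance piece is constructed here; (c) pre-cluster-expansion ((H5)).  NOT summit
progress; NOT continuum; NOT Clay.  Imports `BIJ88WalkProductCutoffVolFree312`, `BIJ88WalkIneq312RemainderBdryNC`,
`BIJ88WalkLocalTermCountW312`, `BIJ88WalkWeightedLocalitySupports`; modifies nothing.
-/

noncomputable section

namespace Literature.MathematicalPhysics.QuantumFieldTheory.BalabanImbrieJaffe1984to88.BIJ88WalkProductCutoffWeighted312

open Classical MeasureTheory Matrix Finset
open scoped BigOperators ContDiff
open Literature.MathematicalPhysics.QuantumFieldTheory.Balaban1983to89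
open B2Eq228Conditioning (weight source)
open BIJ88PolymerRep5134 (corner)
open BIJ88PolymerRep5134Gauss (prec src)
open BIJ88SlotMomentsGauss308 (fieldLaw)
open BIJ88VertexIbp311 (vexp)
open BIJ88WickDerivatives305 (dlist)
open BIJ88VertexComponents311 (maxArity)
open BIJ88WalkRun311 BIJ88WalkExpansion311 BIJ88WalkExpansionGeo311 BIJ88WalkTermCount312
  BIJ88WalkRemainderActivity312 BIJ88WalkIneq312Remainder BIJ88WalkProductCutoffVolFree312
  BIJ88WalkIneq312RemainderBdryNC BIJ88WalkLocalTermCountW312 BIJ88WalkWeightedLocalitySupports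

variable {ι : Type} [Fintype ι] {κ : Type} [LinearOrder κ] {P : Type} [Fintype P] {β : Type} [DecidableEq β]
variable {α I : Type} [Fintype α] [DecidableEq α] [Fintype I] [DecidableEq I]
  {blk : α → I} {Δ : Matrix α α ℝ} {ℱ : α → ℝ} {W : Finset I}

/-- **PRODUCT CUTOFFS, `hE` DISCHARGED, LOCAL COUNT ABSTRACTED**: `BIJ88WalkProductCutoffVolFree312.ineq312_remainder_bdry_prodCutoff_N`
with the locality letters (`ρ₀`, `N₀`) replaced by `hcount : ∀ O, Σ_{t nondegenerate} Π pw ≤ C_O`; conclusion with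
`c_F(O) = K_V·Λ_O·C_O`, `Λ_O = a_O^{Φ₀(O)}·Σ_{N≤Φ₀(O)}2^N(μ_*^N + 1 + v_*^N(2N−1)‼)`.
[cite: BalabanImbrieJaffe1988, §5.14 p.312 (estimate preceding (5.14.5)); p.310; (5.2.1)-(5.2.4) p.278] -/
theorem ineq312_remainder_bdry_prodCutoff_NC (hPD : (prec blk Δ W (corner ℝ W)).PosDef)
    {Cov : P → Matrix {x : α // blk x ∈ W} {x : α // blk x ∈ W} ℝ} {trig : P → Bool} {c : ι → ℝ}
    {legs : ι → List ({x : α // blk x ∈ W} → ℝ)} {obs : κ → List ({x : α // blk x ∈ W} → ℝ)} {M : ℕ}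
    {oc : κ → Finset β} {vc : ι → Finset β} {reg : P → Finset β}
    {Dir : Set ({x : α // blk x ∈ W} → ℝ)} {B' ρ : P → ℝ} {cV : ι → ℝ} {Bl θ θv θw : ℝ} {C : Finset κ → ℝ}
    {B : Type} (Bs : Finset B) (ℓ : B → ({x : α // blk x ∈ W} → ℝ) →L[ℝ] ℝ)
    {g : ℝ → ℝ} (hg : ContDiff ℝ ∞ g) {cg : ℝ}
    (hgc : ∀ (n : ℕ) (x : ℝ), |iteratedDeriv n g x| ≤ cg ^ n * (n : ℝ) ^ (cg * n))
    {KV p μs vs : ℝ} (hV : ∀ φ, |vexp c legs φ| ≤ KV) (hp1 : 1 ≤ p) (hμs : 0 ≤ μs) (hvs : 0 ≤ vs)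
    (hobsm : ∀ j, ∀ w ∈ obs j, |w ⬝ᵥ ((prec blk Δ W (corner ℝ W))⁻¹ *ᵥ src blk ℱ W)| ≤ μs ∧
      w ⬝ᵥ ((prec blk Δ W (corner ℝ W))⁻¹ *ᵥ w) ≤ vs)
    (hlegsm : ∀ m, ∀ w ∈ legs m, |w ⬝ᵥ ((prec blk Δ W (corner ℝ W))⁻¹ *ᵥ src blk ℱ W)| ≤ μs ∧
      w ⬝ᵥ ((prec blk Δ W (corner ℝ W))⁻¹ *ᵥ w) ≤ vs)
    (hθ0 : 0 < θ) (hθ1 : θ ≤ 1) (hBl : 1 ≤ Bl) (hB0 : ∀ p, 0 ≤ B' p) (hρ : ∀ p, 0 ≤ ρ p) (hcV0 : ∀ m, 0 ≤ cV m)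
    (hθv : 0 < θv) (hθv1 : θv ≤ 1) (hθw : 0 < θw) (hθw1 : θw ≤ 1)
    (hB : ∀ p, ∀ u ∈ Dir, ∀ w ∈ Dir, |(Cov p *ᵥ u) ⬝ᵥ w| ≤ B' p * ρ p)
    (hBf : ∀ p, ∀ u ∈ Dir, |(Cov p *ᵥ u) ⬝ᵥ src blk ℱ W| ≤ B' p * ρ p)
    (hBzN : ∀ p, ∀ u ∈ Dir, (∑ b ∈ Bs, |ℓ b (Cov p *ᵥ u)|) ≤ B' p * ρ p)
    (hcV : ∀ m, |c m| ≤ cV m) (hobs : ∀ j, ∀ w ∈ obs j, w ∈ Dir) (hlegs : ∀ m, ∀ w ∈ legs m, w ∈ Dir)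
    (hloc : ∀ p, trig p = false → B' p ≤ Bl ∧ reg p = ∅) (hwalk : ∀ p, trig p = true → B' p ≤ θw * θ ^ (reg p).card)
    (hvert : ∀ m, cV m * Bl ^ (legs m).length ≤ θv * θ ^ (vc m).card)
    (hcount : ∀ O : Finset κ, ((expand Cov trig (src blk ℱ W) c legs obs M 0 O).map fun t =>
      if NondegT t then ((t.consts + t.groups).map (pw ρ)).prod else 0).sum ≤ C O)
    (bdry : Finset κ)
    (hbeat : ∀ O : Finset κ, ∀ t ∈ expand Cov trig (src blk ℱ W) c legs obs M 0 O, t.consts = 0 → ∀ X ∈ t.groups,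
      max p⁻¹ (max (θv ^ M) θw) * ∏ j ∈ X.lab.filter (fun j => j ∉ bdry), Bl ^ (obs j).length ≤ 1) :
    BIJ88Sect5StatementsPart4.Ineq312 (remSys κ β)
      (fun OX => remAt (prec blk Δ W (corner ℝ W)) Cov trig (src blk ℱ W) c legs obs M
        (fun ψ => ∏ b ∈ Bs, g (p⁻¹ * ℓ b ψ)) oc vc reg [] 0 OX.1 OX.2
        / ∫ φ, weight (prec blk Δ W (corner ℝ W)) φ * source (src blk ℱ W) φ)
      (fun OX => KV * ((max 1 (max 1 cg * (max 1 (phi0 legs obs M OX.1 : ℝ)) ^ cg)) ^ phi0 legs obs M OX.1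
            * ∑ N ∈ range (phi0 legs obs M OX.1 + 1), 2 ^ N * (μs ^ N + (1 + vs ^ N * ((2 * N - 1).doubleFactorial : ℝ))))
          * C OX.1)
      (fun OX => ∏ j ∈ OX.1.filter (fun j => j ∈ bdry), Bl ^ (obs j).length)
      (fun OX => nfreeOf oc OX.2) θ 1 := by
  have hp : 0 < p := zero_lt_one.trans_le hp1
  have hKV : 0 ≤ KV := (abs_nonneg _).trans (hV fun _ => 0)
  have hΛ : ∀ O : Finset κ, 0 ≤ (max 1 (max 1 cg * (max 1 (phi0 legs obs M O : ℝ)) ^ cg)) ^ phi0 legs obs M O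
      * ∑ N ∈ range (phi0 legs obs M O + 1), 2 ^ N * (μs ^ N + (1 + vs ^ N * ((2 * N - 1).doubleFactorial : ℝ))) :=
    fun O => mul_nonneg (pow_nonneg (zero_le_one.trans (le_max_left _ _)) _) (Finset.sum_nonneg fun N _ => by positivity)
  exact ineq312_remainder_bdry_NC (N := fun z => ∑ b ∈ Bs, |ℓ b z|) (oc := oc) (vc := vc) (reg := reg) hPD
    (fun z => Finset.sum_nonneg fun b _ => abs_nonneg _) (by simp) hθ0 hθ1 hBl hB0 hρ hcV0 (inv_pos.mpr hp).le
    (inv_le_one_of_one_le₀ hp1) hθv hθv1 hθw hθw1 hB hBf hBzN hcV hobs hlegs hloc hwalk hvert hcount hKV hΛ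
    (fun O t ht h0 => (prodCutoff_hE_N hPD Bs ℓ hg hgc hV hp hμs hvs hobsm hlegsm O t ht h0).trans (le_of_eq (by ring)))
    bdry hbeat

/-- **PRODUCT CUTOFFS, `hE` DISCHARGED, LOCALITY FROM THE REACH OF THE PIECES**:
`BIJ88WalkProductCutoffVolFree312.ineq312_remainder_bdry_prodCutoff_N` with (`ρ₀`, `N₀`) replaced by reach data —
`sees p k` / `reach p k` per direction cube (`C_X` region-local, `C_loc` range-local), directions and vertex legs in
one cube, at most `L` legs per cube, per-cube weight sums `Σ_{p : sees p k} ρ_p ≤ ρ₀`, `Σ_{p : sees p k} ρ_p·|reach p k| ≤ ρ₁`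
(`BIJ88WalkRegionWeightsSummable` for region pieces) —; conclusion with `W_O = max(1, ρ₀Φ₀(O) + Lρ₁)`.
[cite: BalabanImbrieJaffe1988, §5.14 p.310, p.312 (estimate preceding (5.14.5)); Sect. 2 p.264–265; (5.2.1)-(5.2.4) p.278] -/
theorem ineq312_remainder_bdry_prodCutoff_of_reach (hPD : (prec blk Δ W (corner ℝ W)).PosDef)
    {Cov : P → Matrix {x : α // blk x ∈ W} {x : α // blk x ∈ W} ℝ} {trig : P → Bool} {c : ι → ℝ}
    {legs : ι → List ({x : α // blk x ∈ W} → ℝ)} {obs : κ → List ({x : α // blk x ∈ W} → ℝ)} {M : ℕ}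
    {oc : κ → Finset β} {vc : ι → Finset β} {reg : P → Finset β}
    {Dir : Set ({x : α // blk x ∈ W} → ℝ)} {B' ρ : P → ℝ} {cV : ι → ℝ} {Bl θ θv θw ρ₀ ρ₁ : ℝ}
    {K : Type} {cubeOf : {x : α // blk x ∈ W} → K} {sees : P → K → Prop} {reach : P → K → Finset K}
    {legCube : ι → ℕ → K} {L : ℕ}
    {B : Type} (Bs : Finset B) (ℓ : B → ({x : α // blk x ∈ W} → ℝ) →L[ℝ] ℝ)
    {g : ℝ → ℝ} (hg : ContDiff ℝ ∞ g) {cg : ℝ}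
    (hgc : ∀ (n : ℕ) (x : ℝ), |iteratedDeriv n g x| ≤ cg ^ n * (n : ℝ) ^ (cg * n))
    {KV p μs vs : ℝ} (hV : ∀ φ, |vexp c legs φ| ≤ KV) (hp1 : 1 ≤ p) (hμs : 0 ≤ μs) (hvs : 0 ≤ vs)
    (hobsm : ∀ j, ∀ w ∈ obs j, |w ⬝ᵥ ((prec blk Δ W (corner ℝ W))⁻¹ *ᵥ src blk ℱ W)| ≤ μs ∧
      w ⬝ᵥ ((prec blk Δ W (corner ℝ W))⁻¹ *ᵥ w) ≤ vs)
    (hlegsm : ∀ m, ∀ w ∈ legs m, |w ⬝ᵥ ((prec blk Δ W (corner ℝ W))⁻¹ *ᵥ src blk ℱ W)| ≤ μs ∧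
      w ⬝ᵥ ((prec blk Δ W (corner ℝ W))⁻¹ *ᵥ w) ≤ vs)
    (hθ0 : 0 < θ) (hθ1 : θ ≤ 1) (hBl : 1 ≤ Bl) (hB0 : ∀ p, 0 ≤ B' p) (hρ : ∀ p, 0 ≤ ρ p) (hcV0 : ∀ m, 0 ≤ cV m)
    (hθv : 0 < θv) (hθv1 : θv ≤ 1) (hθw : 0 < θw) (hθw1 : θw ≤ 1)
    (hB : ∀ p, ∀ u ∈ Dir, ∀ w ∈ Dir, |(Cov p *ᵥ u) ⬝ᵥ w| ≤ B' p * ρ p)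
    (hBf : ∀ p, ∀ u ∈ Dir, |(Cov p *ᵥ u) ⬝ᵥ src blk ℱ W| ≤ B' p * ρ p)
    (hBzN : ∀ p, ∀ u ∈ Dir, (∑ b ∈ Bs, |ℓ b (Cov p *ᵥ u)|) ≤ B' p * ρ p)
    (hcV : ∀ m, |c m| ≤ cV m) (hobs : ∀ j, ∀ w ∈ obs j, w ∈ Dir) (hlegs : ∀ m, ∀ w ∈ legs m, w ∈ Dir)
    (hloc : ∀ p, trig p = false → B' p ≤ Bl ∧ reg p = ∅) (hwalk : ∀ p, trig p = true → B' p ≤ θw * θ ^ (reg p).card)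
    (hvert : ∀ m, cV m * Bl ^ (legs m).length ≤ θv * θ ^ (vc m).card) (hρ₀0 : 0 ≤ ρ₀)
    (hin : ∀ p (u : {x : α // blk x ∈ W} → ℝ) k, (∀ y, u y ≠ 0 → cubeOf y = k) → Cov p *ᵥ u ≠ 0 → sees p k)
    (hout : ∀ p (u : {x : α // blk x ∈ W} → ℝ) k, (∀ y, u y ≠ 0 → cubeOf y = k) →
      ∀ x, (Cov p *ᵥ u) x ≠ 0 → cubeOf x ∈ reach p k)
    (hDir : ∀ u ∈ Dir, ∃ k, ∀ y, u y ≠ 0 → cubeOf y = k)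
    (hleg : ∀ m j x, ((legs m).getD j 0) x ≠ 0 → cubeOf x = legCube m j)
    (hL : ∀ k, (∑ m, ((range (legs m).length).filter fun j => legCube m j = k).card) ≤ L)
    (hρ₀ : ∀ k, (∑ p ∈ univ.filter (fun p => sees p k), ρ p) ≤ ρ₀)
    (hρ₁ : ∀ k, (∑ p ∈ univ.filter (fun p => sees p k), ρ p * (reach p k).card) ≤ ρ₁)
    (bdry : Finset κ)
    (hbeat : ∀ O : Finset κ, ∀ t ∈ expand Cov trig (src blk ℱ W) c legs obs M 0 O, t.consts = 0 → ∀ X ∈ t.groups,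
      max p⁻¹ (max (θv ^ M) θw) * ∏ j ∈ X.lab.filter (fun j => j ∉ bdry), Bl ^ (obs j).length ≤ 1) :
    BIJ88Sect5StatementsPart4.Ineq312 (remSys κ β)
      (fun OX => remAt (prec blk Δ W (corner ℝ W)) Cov trig (src blk ℱ W) c legs obs M
        (fun ψ => ∏ b ∈ Bs, g (p⁻¹ * ℓ b ψ)) oc vc reg [] 0 OX.1 OX.2
        / ∫ φ, weight (prec blk Δ W (corner ℝ W)) φ * source (src blk ℱ W) φ)
      (fun OX => KV * ((max 1 (max 1 cg * (max 1 (phi0 legs obs M OX.1 : ℝ)) ^ cg)) ^ phi0 legs obs M OX.1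
            * ∑ N ∈ range (phi0 legs obs M OX.1 + 1), 2 ^ N * (μs ^ N + (1 + vs ^ N * ((2 * N - 1).doubleFactorial : ℝ))))
          * (max 1 (ρ₀ * (phi0 legs obs M OX.1 : ℝ) + L * ρ₁)) ^ phi0 legs obs M OX.1)
      (fun OX => ∏ j ∈ OX.1.filter (fun j => j ∈ bdry), Bl ^ (obs j).length)
      (fun OX => nfreeOf oc OX.2) θ 1 := by
  have hp : 0 < p := zero_lt_one.trans_le hp1
  have hKV : 0 ≤ KV := (abs_nonneg _).trans (hV fun _ => 0)
  have hΛ : ∀ O : Finset κ, 0 ≤ (max 1 (max 1 cg * (max 1 (phi0 legs obs M O : ℝ)) ^ cg)) ^ phi0 legs obs M O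
      * ∑ N ∈ range (phi0 legs obs M O + 1), 2 ^ N * (μs ^ N + (1 + vs ^ N * ((2 * N - 1).doubleFactorial : ℝ))) :=
    fun O => mul_nonneg (pow_nonneg (zero_le_one.trans (le_max_left _ _)) _) (Finset.sum_nonneg fun N _ => by positivity)
  have hWL := weighted_locality_of_reach (Cov := Cov) (legs := legs) (Dir := Dir) hin hout hDir hleg hL hρ hρ₀ hρ₁
  exact ineq312_remainder_bdry_NC (N := fun z => ∑ b ∈ Bs, |ℓ b z|) (oc := oc) (vc := vc) (reg := reg)
    (C := fun O => (max 1 (ρ₀ * (phi0 legs obs M O : ℝ) + L * ρ₁)) ^ phi0 legs obs M O) hPD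
    (fun z => Finset.sum_nonneg fun b _ => abs_nonneg _) (by simp) hθ0 hθ1 hBl hB0 hρ hcV0 (inv_pos.mpr hp).le
    (inv_le_one_of_one_le₀ hp1) hθv hθv1 hθw hθw1 hB hBf hBzN hcV hobs hlegs hloc hwalk hvert
    (fun O => expand_lsum_init_le_W (trig := trig) (f := src blk ℱ W) (c := c) hobs hlegs hρ hρ₀0 hWL.1 hWL.2 O
      (le_max_left _ _) (le_max_right _ _))
    hKV hΛ
    (fun O t ht h0 => (prodCutoff_hE_N hPD Bs ℓ hg hgc hV hp hμs hvs hobsm hlegsm O t ht h0).trans (le_of_eq (by ring)))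
    bdry hbeat

end Literature.MathematicalPhysics.QuantumFieldTheory.BalabanImbrieJaffe1984to88.BIJ88WalkProductCutoffWeighted312

end
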